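import Summits.QuantumFields.BalabanUV.Beta.EriceRemainderEnclosureHistoryAutonomyThreshold
import Literature.MathematicalPhysics.QuantumFieldTheory.Balaban1983to89.T4TwoLoopLaw

/-!
# EriceRemainderEnclosureHistoryAutonomyTelescoping — (E43a, first half) TELESCOPING SUMS for the bootstrap of (E43):
# `Σ_{l<m} (l+1)^{−3∕4} ≤ 4·⁴√m`, `Σ_{l<m} (l+2)^{−5∕4} ≤ 4`, `Σ_{l∈[n,N)} (l+2)^{−3∕2} ≤ 2∕√(n+1)` — each by an explicit telescoping
# inequality (`⁴√x` written as `√(√x)`, no `rpow`); `Σ (l+1)^{−1∕2} ≤ 2√m` and `Σ (l+1)^{−3∕2} ≤ 3` are node U2's (`T4OneLoopAsymptotics`, `T4TwoLoopLaw`)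

Cell `pub-balaban`, β-function sub-cell, BINDER row D4 «RemainderConst leaves for Bałaban's split» (`HOME/BINDER-OWNERS.md`; owner
lineage `b2b-balaban-beta-an4`; this file by co-owner #2 lineage `b2b-balaban-beta-d4-p2`, generation 40), β-FLOW TEAM duty (1),
FREEZE (0) honoured (def-free; elementary real analysis only; imports (E38a) merely to sit in the series' import chain).

HONEST FRAMING (page 1, verbatim and binding).  *"Discharging BetaPertH makes Bałaban's UV stability UNCONDITIONAL — a real
constructive-QFT result; it is NOT the continuum limit and NOT the Clay problem."*  THIS FILE DISCHARGES NOTHING OF THE KIND — it contains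
no statement about flows at all.  Row D4 class UNCHANGED (critical-path width 0; instance 0∕1; D4 DISCHARGE NO DATE).  HONEST DEPENDENCY:
continuum YM on T⁴ ⇐ BetaPertH ∧ nine spine estimates (0/9 proved); BetaPertH ⇐ (D1) ∧ (D4) ∧ CAP+tail; G-an2-4 gates asym, D1 and NE2/3/4.

WHAT IS PROVED ([folklore]; 0 `def`, 0 sorry).  `inv_qrt_cube_le`, **`sum_inv_qrt_cube_le`**, `inv_mul_qrt_le`, **`sum_inv_mul_qrt_le`**, `inv_mul_sqrt_le`,
**`sum_Ico_inv_mul_sqrt_le`**.  REUSED BY NAME (already in the tree, found by the gate's `dedup.landed` at dry-run): node U2's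
`T4OneLoopAsymptotics.inv_sqrt_succ_le` ∕ `sum_inv_sqrt_succ_le` (`Σ_{l<m}(l+1)^{−1∕2} ≤ 2√m`) and `T4TwoLoopLaw.sum_inv_mul_sqrt_succ_le`
(`Σ_{l<N}(l+1)^{−3∕2} ≤ 3`) — hence the import of `T4TwoLoopLaw`; the fourth-root identity `√(√x)⁴ = x` is inlined.
-/

noncomputable section
open Filter Topology Finset

namespace Summit.QuantumFields.BalabanUV.Beta.EriceRemainderEnclosureHistoryAutonomyTelescoping

open Literature.MathematicalPhysics.QuantumFieldTheory.Balaban1983to89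
open Literature.MathematicalPhysics.QuantumFieldTheory.Balaban1983to89.T4BetaStationary
open Literature.MathematicalPhysics.QuantumFieldTheory.Balaban1983to89.T4BetaFlowWellPosed
open Summit.QuantumFields.BalabanUV.Beta.EriceRemainderEnclosureHistoryAutonomyWellPosed
open Summit.QuantumFields.BalabanUV.Beta.EriceRemainderEnclosureHistoryAutonomyThreshold

/-! ## §1 Telescoping sums: `Σ l^{−3∕4} ≤ 4m^{1∕4}`, `Σ_{l≥2} l^{−5∕4} ≤ 4`, tails `Σ_{l≥n} l^{−3∕2} ≤ 2∕√n` -/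

/-- `1∕q(m+1)³ ≤ 4(q(m+1) − q(m))`, `q = ⁴√·`. [folklore] -/
theorem inv_qrt_cube_le (m : ℕ) :
    1 / Real.sqrt (Real.sqrt ((m : ℝ) + 1)) ^ 3
      ≤ 4 * (Real.sqrt (Real.sqrt ((m : ℝ) + 1)) - Real.sqrt (Real.sqrt (m : ℝ))) := by
  set A := Real.sqrt (Real.sqrt ((m : ℝ) + 1)) with hA
  set Bq := Real.sqrt (Real.sqrt (m : ℝ)) with hBq
  have hA0 : 0 < A := Real.sqrt_pos.2 (Real.sqrt_pos.2 (by positivity))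
  have hB0 : 0 ≤ Bq := Real.sqrt_nonneg _
  have hBA : Bq ≤ A := Real.sqrt_le_sqrt (Real.sqrt_le_sqrt (by linarith))
  have hA4 : A ^ 4 = (m : ℝ) + 1 :=
    (by rw [show (4 : ℕ) = 2 * 2 by norm_num, pow_mul, Real.sq_sqrt (Real.sqrt_nonneg _), Real.sq_sqrt (by positivity)])
  have hB4 : Bq ^ 4 = (m : ℝ) := by
    rw [show (4 : ℕ) = 2 * 2 by norm_num, pow_mul, Real.sq_sqrt (Real.sqrt_nonneg _), Real.sq_sqrt (Nat.cast_nonneg m)]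
  rw [div_le_iff₀ (by positivity)]
  -- 1 = A⁴ − B⁴ = (A − B)(A³ + A²B + AB² + B³) ≤ (A − B)·4A³
  have e : A ^ 4 - Bq ^ 4 = (A - Bq) * (A ^ 3 + A ^ 2 * Bq + A * Bq ^ 2 + Bq ^ 3) := by ring
  have h1 : A ^ 3 + A ^ 2 * Bq + A * Bq ^ 2 + Bq ^ 3 ≤ 4 * A ^ 3 := by
    nlinarith [pow_le_pow_left₀ hB0 hBA 2, pow_le_pow_left₀ hB0 hBA 3, mul_le_mul_of_nonneg_left hBA (sq_nonneg A),
      mul_le_mul (le_refl A) (pow_le_pow_left₀ hB0 hBA 2) (sq_nonneg Bq) hA0.le]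
  have hAB : 0 ≤ A - Bq := sub_nonneg.2 hBA
  nlinarith [mul_le_mul_of_nonneg_left h1 hAB]

/-- `Σ_{l<m} 1∕q(l+1)³ ≤ 4·q(m)`, i.e. `Σ_{l≤m} l^{−3∕4} ≤ 4m^{1∕4}`. [folklore] -/
theorem sum_inv_qrt_cube_le (m : ℕ) :
    ∑ l ∈ range m, 1 / Real.sqrt (Real.sqrt ((l : ℝ) + 1)) ^ 3 ≤ 4 * Real.sqrt (Real.sqrt (m : ℝ)) := by
  induction m with
  | zero => simp
  | succ m ih =>
    rw [sum_range_succ, Nat.cast_succ]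
    have := inv_qrt_cube_le m
    linarith

/-- `1∕((m+2)·q(m+2)) ≤ 4(1∕q(m+1) − 1∕q(m+2))`. [folklore] -/
theorem inv_mul_qrt_le (m : ℕ) :
    1 / (((m : ℝ) + 2) * Real.sqrt (Real.sqrt ((m : ℝ) + 2)))
      ≤ 4 * (1 / Real.sqrt (Real.sqrt ((m : ℝ) + 1)) - 1 / Real.sqrt (Real.sqrt ((m : ℝ) + 2))) := by
  set A := Real.sqrt (Real.sqrt ((m : ℝ) + 2)) with hA
  set Bq := Real.sqrt (Real.sqrt ((m : ℝ) + 1)) with hBq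
  have hA0 : 0 < A := Real.sqrt_pos.2 (Real.sqrt_pos.2 (by positivity))
  have hB0 : 0 < Bq := Real.sqrt_pos.2 (Real.sqrt_pos.2 (by positivity))
  have hBA : Bq ≤ A := Real.sqrt_le_sqrt (Real.sqrt_le_sqrt (by linarith))
  have hA4 : A ^ 4 = (m : ℝ) + 2 :=
    (by rw [show (4 : ℕ) = 2 * 2 by norm_num, pow_mul, Real.sq_sqrt (Real.sqrt_nonneg _), Real.sq_sqrt (by positivity)])
  have hB4 : Bq ^ 4 = (m : ℝ) + 1 :=
    (by rw [show (4 : ℕ) = 2 * 2 by norm_num, pow_mul, Real.sq_sqrt (Real.sqrt_nonneg _), Real.sq_sqrt (by positivity)])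
  -- `A − B ≥ 1∕(4A³)` as above, with `A⁴ − B⁴ = 1`
  have hdiff : 1 ≤ 4 * A ^ 3 * (A - Bq) := by
    have e : A ^ 4 - Bq ^ 4 = (A - Bq) * (A ^ 3 + A ^ 2 * Bq + A * Bq ^ 2 + Bq ^ 3) := by ring
    have h1 : A ^ 3 + A ^ 2 * Bq + A * Bq ^ 2 + Bq ^ 3 ≤ 4 * A ^ 3 := by
      nlinarith [pow_le_pow_left₀ hB0.le hBA 2, pow_le_pow_left₀ hB0.le hBA 3, mul_le_mul_of_nonneg_left hBA (sq_nonneg A),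
        mul_le_mul (le_refl A) (pow_le_pow_left₀ hB0.le hBA 2) (sq_nonneg Bq) hA0.le]
    nlinarith [mul_le_mul_of_nonneg_left h1 (sub_nonneg.2 hBA)]
  rw [← hA4]
  rw [show 4 * (1 / Bq - 1 / A) = 4 * (A - Bq) / (A * Bq) by field_simp]
  rw [div_le_div_iff₀ (by positivity) (by positivity), one_mul]
  -- A·B ≤ 4(A − B)·A⁴·A = (4A³(A−B))·A²... : A * Bq ≤ 4 * (A - Bq) * (A ^ 4 * A)
  calc A * Bq ≤ A * A := mul_le_mul_of_nonneg_left hBA hA0.le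
    _ = 1 * (A * A) := by ring
    _ ≤ (4 * A ^ 3 * (A - Bq)) * (A * A) := mul_le_mul_of_nonneg_right hdiff (by positivity)
    _ = 4 * (A - Bq) * (A ^ 4 * A) := by ring

/-- `Σ_{l<m} 1∕((l+2)·q(l+2)) ≤ 4`, i.e. `Σ_{l≥2} l^{−5∕4} ≤ 4`. [folklore] -/
theorem sum_inv_mul_qrt_le (m : ℕ) :
    ∑ l ∈ range m, 1 / (((l : ℝ) + 2) * Real.sqrt (Real.sqrt ((l : ℝ) + 2))) ≤ 4 := by
  have key : ∀ m : ℕ, ∑ l ∈ range m, 1 / (((l : ℝ) + 2) * Real.sqrt (Real.sqrt ((l : ℝ) + 2)))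
      ≤ 4 * (1 - 1 / Real.sqrt (Real.sqrt ((m : ℝ) + 1))) := by
    intro m
    induction m with
    | zero => simp
    | succ m ih =>
      rw [sum_range_succ, Nat.cast_succ]
      have := inv_mul_qrt_le m
      have e : ((m : ℝ) + 1 + 1) = (m : ℝ) + 2 := by ring
      rw [e]
      linarith
  refine (key m).trans ?_
  have : 0 ≤ 1 / Real.sqrt (Real.sqrt ((m : ℝ) + 1)) := by positivity
  linarith

/-- `1∕((m+2)√(m+2)) ≤ 2(1∕√(m+1) − 1∕√(m+2))`. [folklore] -/
theorem inv_mul_sqrt_le (m : ℕ) :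
    1 / (((m : ℝ) + 2) * Real.sqrt ((m : ℝ) + 2)) ≤ 2 * (1 / Real.sqrt ((m : ℝ) + 1) - 1 / Real.sqrt ((m : ℝ) + 2)) := by
  set A := Real.sqrt ((m : ℝ) + 2) with hA
  set Bq := Real.sqrt ((m : ℝ) + 1) with hBq
  have hA0 : 0 < A := Real.sqrt_pos.2 (by positivity)
  have hB0 : 0 < Bq := Real.sqrt_pos.2 (by positivity)
  have hBA : Bq ≤ A := Real.sqrt_le_sqrt (by linarith)
  have hA2 : A ^ 2 = (m : ℝ) + 2 := Real.sq_sqrt (by positivity)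
  have hB2 : Bq ^ 2 = (m : ℝ) + 1 := Real.sq_sqrt (by positivity)
  have hdiff : 1 ≤ 2 * A * (A - Bq) := by nlinarith
  rw [← hA2, show 2 * (1 / Bq - 1 / A) = 2 * (A - Bq) / (A * Bq) by field_simp,
    div_le_div_iff₀ (by positivity) (by positivity), one_mul]
  calc A * Bq ≤ A * A := mul_le_mul_of_nonneg_left hBA hA0.le
    _ = 1 * (A * A) := by ring
    _ ≤ (2 * A * (A - Bq)) * (A * A) := mul_le_mul_of_nonneg_right hdiff (by positivity)
    _ = 2 * (A - Bq) * (A ^ 2 * A) := by ring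

/-- TAIL: `Σ_{l ∈ [n, N)} 1∕((l+2)√(l+2)) ≤ 2∕√(n+1)`. [folklore] -/
theorem sum_Ico_inv_mul_sqrt_le (n N : ℕ) :
    ∑ l ∈ Ico n N, 1 / (((l : ℝ) + 2) * Real.sqrt ((l : ℝ) + 2)) ≤ 2 / Real.sqrt ((n : ℝ) + 1) := by
  rcases le_or_gt N n with hNn | hnN
  · rw [Ico_eq_empty (by omega), sum_empty]; positivity
  · have key : ∀ N, n ≤ N → ∑ l ∈ Ico n N, 1 / (((l : ℝ) + 2) * Real.sqrt ((l : ℝ) + 2))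
        ≤ 2 * (1 / Real.sqrt ((n : ℝ) + 1) - 1 / Real.sqrt ((N : ℝ) + 1)) := by
      intro N hN
      induction N, hN using Nat.le_induction with
      | base => simp
      | succ N hN ih =>
        rw [sum_Ico_succ_top hN, Nat.cast_succ]
        have := inv_mul_sqrt_le N
        have e : ((N : ℝ) + 1 + 1) = (N : ℝ) + 2 := by ring
        rw [e]
        linarith
    refine (key N hnN.le).trans ?_
    have : 0 ≤ 1 / Real.sqrt ((N : ℝ) + 1) := by positivity
    rw [div_eq_mul_one_div 2]
    linarith

end Summit.QuantumFields.BalabanUV.Beta.EriceRemainderEnclosureHistoryAutonomyTelescoping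

end
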